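import Summits.CriticalPhenomena.PercolationContinuityZ3.Theorems.PercAnnulusCrossingIICVolumePolylogEnvelope
import HarnessLib

/-!
# A.S. DOUBLING REGULARITY of the volume of Kesten's planar IIC: `V_{2n} ≤ A(1 + log 2n)^C · V_n` eventually (lane RSW3, p1 gen 16)

builds on p205010 (kernel theorem, internal audit signed; external expert review pending) — NOT used in this file (`ℤ²` at `p_c = 1/2`).

Seat `prim-rsw3-p1` (gen 16); memo `run/shared/lean/prim/rsw3/P1-QM.md` §29.  Helper file for the crux `stmt-CriticalPhenomena-4575` chain; no
definitions, no sorries.  A corollary of the two-sided polylog envelope (`…IICVolumePolylogEnvelope`): since `π(2n) ≤ π(n)`,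
`V_{2n} ≤ 16(1+log 2n)²(2n)²π(2n) ≤ 64(1+log 2n)²·n²π(n) ≤ 64A(1+log 2n)²(1+log n)^C·V_n`.

* **`iicMeasure_ae_eventually_volume_doubling_Z2`** — there are `A, C > 0` such that for EVERY measure `ν` with Kesten's IIC limit property at
  `p_c(ℤ²) = 1/2`: `ν`-a.s. eventually **`|C(0) ∩ Λ(2n)| ≤ A (1 + log (2n))^C · |C(0) ∩ Λ(n)|`** — the volume growth of the IIC is doubling-regular up
  to polylogarithmic factors, almost surely (no exponent assumed to exist).
References: H. Kesten, PTRF 73 (1986), Thm. (8).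
-/

noncomputable section

namespace Summit.CriticalPhenomena.PercolationContinuityZ3.Theorems.Crossing

open MeasureTheory Filter Topology Literature.Probability.Percolation Literature.Probability.LatticeModels
open Literature.Probability.Percolation.DCT16 Literature.Probability.Percolation.DKT20
open scoped Literature.Probability.Percolation ENNReal

open Classical in
/-- **A.S. DOUBLING REGULARITY OF THE IIC VOLUME** (`ℤ²`, every IIC measure at `p_c = 1/2`): there are `A, C > 0` with, `ν`-a.s. eventually,
`V_{2n} ≤ A(1 + log(2n))^C V_n`. [cite: Kesten1986, Thm. (8)] -/
theorem iicMeasure_ae_eventually_volume_doubling_Z2 :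
    ∃ A C : ℝ, 0 < A ∧ 0 < C ∧ ∀ (ν : Measure (BondConfig (Site 2))) [IsProbabilityMeasure ν],
      (∀ (F : Finset (Sym2 (Site 2))) (E : Set (BondConfig (Site 2))), MeasurableSet E → DeterminedBy E ↑F →
        Tendsto (fun n : ℕ => (bondPercolation (zdGraph 2) (criticalProbI 2)).real (E ∩ siteToBoundary 2 n) /
          oneArmProb 2 (criticalProbI 2) n) atTop (𝓝 (ν.real E))) →
      ∀ᵐ ω ∂ν, ∀ᶠ n : ℕ in atTop,
        ((((box 2 (2 * n)).filter fun z => ω ∈ (openConn (0 : Site 2) z : Set (BondConfig (Site 2)))).card : ℕ) : ℝ) ≤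
          A * (1 + Real.log ((2 * n : ℕ) : ℝ)) ^ C *
            ((((box 2 n).filter fun z => ω ∈ (openConn (0 : Site 2) z : Set (BondConfig (Site 2)))).card : ℕ) : ℝ) := by
  classical
  obtain ⟨A, C, hA, hC, hlow⟩ := iicMeasure_ae_eventually_volume_ge_div_log_pow_Z2
  refine ⟨64 * A, C + 2, by positivity, by positivity, fun ν _ hν => ?_⟩
  have hup := iicMeasure_ae_eventually_volume_le_log_sq_Z2 hν
  filter_upwards [hup, hlow ν hν] with ω hω1 hω2
  -- the upper envelope at `2n`: pull back along `n ↦ 2n`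
  have hω1' : ∀ᶠ n : ℕ in atTop,
      ((((box 2 (2 * n)).filter fun z => ω ∈ (openConn (0 : Site 2) z : Set (BondConfig (Site 2)))).card : ℕ) : ℝ) ≤
        16 * (1 + Real.log ((2 * n : ℕ) : ℝ)) ^ 2 * ((((2 * n : ℕ) : ℝ)) ^ 2 * oneArmProb 2 (criticalProbI 2) (2 * n)) :=
    (tendsto_id.const_mul_atTop' (by norm_num : 0 < 2)).eventually hω1
  refine ((hω1'.and hω2).and (eventually_ge_atTop 1)).mono fun n hn => ?_
  obtain ⟨⟨h1, h2⟩, hn1⟩ := hn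
  have hn0 : (0 : ℝ) < n := by exact_mod_cast hn1
  have hπ : oneArmProb 2 (criticalProbI 2) (2 * n) ≤ oneArmProb 2 (criticalProbI 2) n := DCT16.real_siteToBoundary_antitone _ (by omega)
  have hπ0 : 0 ≤ oneArmProb 2 (criticalProbI 2) (2 * n) := measureReal_nonneg
  have hL1 : (1 : ℝ) ≤ 1 + Real.log n := by linarith [Real.log_nonneg (show (1 : ℝ) ≤ n by exact_mod_cast hn1)]
  have hL2 : 1 + Real.log (n : ℝ) ≤ 1 + Real.log ((2 * n : ℕ) : ℝ) := by
    push_cast; linarith [Real.log_le_log hn0 (show (n : ℝ) ≤ 2 * n by linarith)]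
  have hL2' : (0 : ℝ) ≤ 1 + Real.log ((2 * n : ℕ) : ℝ) := le_trans (by linarith) hL2
  set V := ((((box 2 n).filter fun z => ω ∈ (openConn (0 : Site 2) z : Set (BondConfig (Site 2)))).card : ℕ) : ℝ) with hV
  have hV0 : 0 ≤ V := Nat.cast_nonneg _
  -- `(2n)² π(2n) ≤ 4 n² π(n) ≤ 4 A (1+log n)^C V`
  have hstep : (((2 * n : ℕ) : ℝ)) ^ 2 * oneArmProb 2 (criticalProbI 2) (2 * n) ≤ 4 * (A * (1 + Real.log n) ^ C * V) := by
    calc (((2 * n : ℕ) : ℝ)) ^ 2 * oneArmProb 2 (criticalProbI 2) (2 * n) ≤ (4 * (n : ℝ) ^ 2) * oneArmProb 2 (criticalProbI 2) n := by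
          refine mul_le_mul (by push_cast; nlinarith) hπ hπ0 (by positivity)
      _ = 4 * ((n : ℝ) ^ 2 * oneArmProb 2 (criticalProbI 2) n) := by ring
      _ ≤ 4 * (A * (1 + Real.log n) ^ C * V) := mul_le_mul_of_nonneg_left h2 (by norm_num)
  have hpowC : (1 + Real.log (n : ℝ)) ^ C ≤ (1 + Real.log ((2 * n : ℕ) : ℝ)) ^ C := Real.rpow_le_rpow (by linarith) hL2 hC.le
  calc ((((box 2 (2 * n)).filter fun z => ω ∈ (openConn (0 : Site 2) z : Set (BondConfig (Site 2)))).card : ℕ) : ℝ)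
      ≤ 16 * (1 + Real.log ((2 * n : ℕ) : ℝ)) ^ 2 * (4 * (A * (1 + Real.log n) ^ C * V)) :=
        h1.trans (mul_le_mul_of_nonneg_left hstep (by positivity))
    _ ≤ 16 * (1 + Real.log ((2 * n : ℕ) : ℝ)) ^ 2 * (4 * (A * (1 + Real.log ((2 * n : ℕ) : ℝ)) ^ C * V)) := by
        refine mul_le_mul_of_nonneg_left (mul_le_mul_of_nonneg_left ?_ (by norm_num)) (by positivity)
        exact mul_le_mul_of_nonneg_right (mul_le_mul_of_nonneg_left hpowC hA.le) hV0
    _ = 64 * A * (1 + Real.log ((2 * n : ℕ) : ℝ)) ^ (C + 2) * V := by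
        rw [Real.rpow_add (by linarith), Real.rpow_two]; ring

end Summit.CriticalPhenomena.PercolationContinuityZ3.Theorems.Crossing

end
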